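import Summits.PneNP.PneNP.Theorems.ReslinSizeFromWidthPCDegreeGap
import Literature.Computability.MetaComplexity.ResolutionWidth
import HarnessLib

/-!
# PneNP / ReslinSizeFromWidth — padding a uniform CNF raises resolution width by exactly one

Helper file for the INPUT side of crux `ResLinSizeFromWidth` (stmt-PneNP-18932); first half of the
"gap at every width" construction (second half: `ReslinSizeFromWidthPCDegreeGapFamily.lean`).
Padding each clause `C` (index `i`) of a `w`-uniform CNF `Φ` whose variables are `< B` with the two
fresh variables `y = B + 2i`, `z = B + 2i + 1`,

  `C  ↦  { y ∨ C,   ¬y ∨ z ∨ C.tail,   ¬z ∨ C }`      (`padTriple`, `padCNF`),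

gives a `(w+1)`-uniform CNF (`length_of_mem_padTriple`) on distinct variables
(`nodup_of_mem_padTriple`), with variables `< B + 2|Φ|` (`lt_of_mem_padTriple`), in which a clause
is determined by its set of variables WHATEVER `Φ` is (`eq_of_varset_eq_padCNF`: the fresh variables
mark the clause — `{y}`, `{y, z}`, `{z}` — `even_marker_mem`, `odd_marker_mem`), and from which every
old clause is re-derived by two resolution steps inside width `w + 1`
(`resDerivable_of_mem_of_padCNF`), so that `clauseSet Φ ⊢_w ∅` gives `clauseSet (padCNF B Φ) ⊢_{w+1} ∅`
(`resDerivable_padCNF`, Ben-Sasson–Wigderson's `⊢_w` = `ResDerivable`, cut = `trans_axioms`).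

References: E. Ben-Sasson, A. Wigderson, J. ACM 48 (2001), §2.3 (`F ⊢_w E`); the rest as in
`ReslinSizeFromWidthPCDegreeGap.lean`.
-/

noncomputable section

namespace Summit.PneNP.PneNP.Theorems

-- `Summit.PneNP.PneNP` repeats a path component by design (summit = sub-problem); silence the linter.
set_option linter.dupNamespace false

namespace ResLinPC

open MvPolynomial Finset
open Literature.Computability.Complexity Literature.Computability.MetaComplexity
open Summit.PneNP.PneNP.Theorems.PolyCalc

/-! ### Padding a clause with two fresh variables -/

/-- The three clauses replacing `C` (index `i`, fresh variables `y = B + 2i`, `z = B + 2i + 1`):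
`y ∨ C`, `¬y ∨ z ∨ C.tail`, `¬z ∨ C`. -/
def padTriple (B i : ℕ) (C : Clause ℕ) : List (Clause ℕ) :=
  [(B + 2 * i, true) :: C, (B + 2 * i, false) :: (B + 2 * i + 1, true) :: C.tail,
    (B + 2 * i + 1, false) :: C]

/-- The padded CNF: the `i`-th clause of `Φ` is replaced by its triple. -/
def padCNF (B : ℕ) (Φ : CNF ℕ) : CNF ℕ :=
  (List.range Φ.length).flatMap fun i => padTriple B i (Φ[i]?.getD [])

/-- Membership in the padded CNF. -/
theorem mem_padCNF_iff {B : ℕ} {Φ : CNF ℕ} {P : Clause ℕ} :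
    P ∈ padCNF B Φ ↔ ∃ i, ∃ hi : i < Φ.length, P ∈ padTriple B i (Φ[i]'hi) := by
  constructor
  · intro h
    obtain ⟨i, hi, hP⟩ := List.mem_flatMap.1 h
    rw [List.mem_range] at hi
    rw [List.getElem?_eq_getElem hi, Option.getD_some] at hP
    exact ⟨i, hi, hP⟩
  · rintro ⟨i, hi, hP⟩
    refine List.mem_flatMap.2 ⟨i, List.mem_range.2 hi, ?_⟩
    rwa [List.getElem?_eq_getElem hi, Option.getD_some]

/-- The triples are clauses of the padded CNF. -/
theorem padTriple_subset_padCNF {B : ℕ} {Φ : CNF ℕ} {i : ℕ} (hi : i < Φ.length) {P : Clause ℕ}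
    (hP : P ∈ padTriple B i (Φ[i]'hi)) : P ∈ padCNF B Φ :=
  mem_padCNF_iff.2 ⟨i, hi, hP⟩

/-- Unfolding membership in a triple. -/
theorem mem_padTriple_iff {B i : ℕ} {C P : Clause ℕ} :
    P ∈ padTriple B i C ↔ P = (B + 2 * i, true) :: C ∨
      P = (B + 2 * i, false) :: (B + 2 * i + 1, true) :: C.tail ∨ P = (B + 2 * i + 1, false) :: C := by
  simp [padTriple]

/-! ### Uniformity, distinct variables, freshness, distinct supports -/

/-- Padded clauses have one more literal (`C` nonempty). -/
theorem length_of_mem_padTriple {B i d : ℕ} {C P : Clause ℕ} (hC : C.length = d) (hd : 1 ≤ d)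
    (hP : P ∈ padTriple B i C) : P.length = d + 1 := by
  rcases mem_padTriple_iff.1 hP with rfl | rfl | rfl
  · rw [List.length_cons, hC]
  · rw [List.length_cons, List.length_cons, List.length_tail, hC]; omega
  · rw [List.length_cons, hC]

/-- Variables of the tail are variables of the clause. -/
private theorem mem_map_fst_of_tail {C : Clause ℕ} {x : ℕ} (hx : x ∈ C.tail.map Prod.fst) :
    x ∈ C.map Prod.fst := by
  obtain ⟨l, hl, rfl⟩ := List.mem_map.1 hx
  exact List.mem_map.2 ⟨l, List.mem_of_mem_tail hl, rfl⟩

/-- Padded clauses sit on distinct variables (the old ones below `B`, the new ones `≥ B`). -/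
theorem nodup_of_mem_padTriple {B i : ℕ} {C P : Clause ℕ} (hC : (C.map Prod.fst).Nodup)
    (hB : ∀ l ∈ C, l.1 < B) (hP : P ∈ padTriple B i C) : (P.map Prod.fst).Nodup := by
  have hy : B + 2 * i ∉ C.map Prod.fst := by
    intro h
    obtain ⟨l, hl, hl1⟩ := List.mem_map.1 h
    have := hB l hl
    omega
  have hz : B + 2 * i + 1 ∉ C.map Prod.fst := by
    intro h
    obtain ⟨l, hl, hl1⟩ := List.mem_map.1 h
    have := hB l hl
    omega
  rcases mem_padTriple_iff.1 hP with rfl | rfl | rfl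
  · rw [List.map_cons, List.nodup_cons]
    exact ⟨hy, hC⟩
  · rw [List.map_cons, List.map_cons, List.nodup_cons, List.nodup_cons]
    refine ⟨?_, fun h => hz (mem_map_fst_of_tail h), ?_⟩
    · rw [List.mem_cons, not_or]
      exact ⟨by simp, fun h => hy (mem_map_fst_of_tail h)⟩
    · rw [List.map_tail]
      exact hC.sublist (List.tail_sublist _)
  · rw [List.map_cons, List.nodup_cons]
    exact ⟨hz, hC⟩

/-- All variables of the padded clauses of index `i < n` are below `B + 2n`. -/
theorem lt_of_mem_padTriple {B i n : ℕ} (hi : i < n) {C P : Clause ℕ} (hB : ∀ l ∈ C, l.1 < B)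
    (hP : P ∈ padTriple B i C) : ∀ l ∈ P, l.1 < B + 2 * n := by
  have hB' : ∀ l ∈ C, l.1 < B + 2 * n := fun l hl => (hB l hl).trans_le (Nat.le_add_right _ _)
  rcases mem_padTriple_iff.1 hP with rfl | rfl | rfl
  · intro l hl
    rcases List.mem_cons.1 hl with rfl | hl
    · simp only; omega
    · exact hB' l hl
  · intro l hl
    rcases List.mem_cons.1 hl with rfl | hl
    · simp only; omega
    rcases List.mem_cons.1 hl with rfl | hl
    · simp only; omega
    · exact hB' l (List.mem_of_mem_tail hl)
  · intro l hl
    rcases List.mem_cons.1 hl with rfl | hl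
    · simp only; omega
    · exact hB' l hl

/-- The fresh markers, even case: the variable `B + 2j` occurs in the first two clauses of the
`i`-th triple iff `j = i`, and never in the third. -/
theorem even_marker_mem {B i j : ℕ} {C : Clause ℕ} (hB : ∀ l ∈ C, l.1 < B) :
    (B + 2 * j ∈ ((B + 2 * i, true) :: C : Clause ℕ).map Prod.fst ↔ j = i) ∧
      (B + 2 * j ∈ ((B + 2 * i, false) :: (B + 2 * i + 1, true) :: C.tail : Clause ℕ).map Prod.fst ↔
        j = i) ∧
      B + 2 * j ∉ ((B + 2 * i + 1, false) :: C : Clause ℕ).map Prod.fst := by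
  have hold : ∀ x, x ∈ C.map Prod.fst → x < B := by
    intro x hx
    obtain ⟨l, hl, rfl⟩ := List.mem_map.1 hx
    exact hB l hl
  have htl : ∀ x, x ∈ C.tail.map Prod.fst → x < B := fun x hx => hold x (mem_map_fst_of_tail hx)
  refine ⟨⟨fun h => ?_, fun h => ?_⟩, ⟨fun h => ?_, fun h => ?_⟩, fun h => ?_⟩
  · rw [List.map_cons, List.mem_cons] at h
    rcases h with h | h
    · simp only at h; omega
    · have := hold _ h; omega
  · subst h; exact List.mem_cons_self
  · rw [List.map_cons, List.map_cons, List.mem_cons, List.mem_cons] at h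
    rcases h with h | h | h
    · simp only at h; omega
    · simp only at h; omega
    · have := htl _ h; omega
  · subst h; exact List.mem_cons_self
  · rw [List.map_cons, List.mem_cons] at h
    rcases h with h | h
    · simp only at h; omega
    · have := hold _ h; omega

/-- The fresh markers, odd case: the variable `B + 2j + 1` occurs in the last two clauses of the
`i`-th triple iff `j = i`, and never in the first. -/
theorem odd_marker_mem {B i j : ℕ} {C : Clause ℕ} (hB : ∀ l ∈ C, l.1 < B) :
    B + 2 * j + 1 ∉ ((B + 2 * i, true) :: C : Clause ℕ).map Prod.fst ∧
      (B + 2 * j + 1 ∈ ((B + 2 * i, false) :: (B + 2 * i + 1, true) :: C.tail : Clause ℕ).map Prod.fst ↔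
        j = i) ∧
      (B + 2 * j + 1 ∈ ((B + 2 * i + 1, false) :: C : Clause ℕ).map Prod.fst ↔ j = i) := by
  have hold : ∀ x, x ∈ C.map Prod.fst → x < B := by
    intro x hx
    obtain ⟨l, hl, rfl⟩ := List.mem_map.1 hx
    exact hB l hl
  have htl : ∀ x, x ∈ C.tail.map Prod.fst → x < B := fun x hx => hold x (mem_map_fst_of_tail hx)
  refine ⟨fun h => ?_, ⟨fun h => ?_, fun h => ?_⟩, ⟨fun h => ?_, fun h => ?_⟩⟩
  · rw [List.map_cons, List.mem_cons] at h
    rcases h with h | h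
    · simp only at h; omega
    · have := hold _ h; omega
  · rw [List.map_cons, List.map_cons, List.mem_cons, List.mem_cons] at h
    rcases h with h | h | h
    · simp only at h; omega
    · simp only at h; omega
    · have := htl _ h; omega
  · subst h
    rw [List.map_cons, List.map_cons]
    exact List.mem_cons_of_mem _ List.mem_cons_self
  · rw [List.map_cons, List.mem_cons] at h
    rcases h with h | h
    · simp only at h; omega
    · have := hold _ h; omega
  · subst h; exact List.mem_cons_self

/-- **Distinct supports in the padded CNF**: a clause of `padCNF B Φ` is determined by its set of
variables (whatever `Φ` is, provided its variables are `< B`): the fresh variables identify the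
index `i` and the member of the triple. -/
theorem eq_of_varset_eq_padCNF {B : ℕ} {Φ : CNF ℕ} (hB : ∀ C ∈ Φ, ∀ l ∈ C, l.1 < B)
    {P Q : Clause ℕ} (hP : P ∈ padCNF B Φ) (hQ : Q ∈ padCNF B Φ)
    (h : (P.map Prod.fst).toFinset = (Q.map Prod.fst).toFinset) : P = Q := by
  have hx : ∀ x, x ∈ P.map Prod.fst ↔ x ∈ Q.map Prod.fst := fun x => by
    rw [← List.mem_toFinset, ← List.mem_toFinset, h]
  obtain ⟨i, hi, hPi⟩ := mem_padCNF_iff.1 hP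
  obtain ⟨j, hj, hQj⟩ := mem_padCNF_iff.1 hQ
  have hBi := hB _ (List.getElem_mem hi)
  have hBj := hB _ (List.getElem_mem hj)
  have eP := even_marker_mem (i := i) (j := i) (C := Φ[i]) hBi
  have oP := odd_marker_mem (i := i) (j := i) (C := Φ[i]) hBi
  have eQ := even_marker_mem (i := j) (j := i) (C := Φ[j]) hBj
  have oQ := odd_marker_mem (i := j) (j := i) (C := Φ[j]) hBj
  -- the index: a marker of `i` occurs in `P`, hence in `Q`, hence `i = j`
  have hij : i = j := by
    rcases mem_padTriple_iff.1 hPi with rfl | rfl | rfl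
    · have hy := (hx _).1 (eP.1.2 rfl)
      rcases mem_padTriple_iff.1 hQj with rfl | rfl | rfl
      exacts [eQ.1.1 hy, eQ.2.1.1 hy, (eQ.2.2 hy).elim]
    · have hy := (hx _).1 (eP.2.1.2 rfl)
      rcases mem_padTriple_iff.1 hQj with rfl | rfl | rfl
      exacts [eQ.1.1 hy, eQ.2.1.1 hy, (eQ.2.2 hy).elim]
    · have hz := (hx _).1 (oP.2.2.2 rfl)
      rcases mem_padTriple_iff.1 hQj with rfl | rfl | rfl
      exacts [(oQ.1 hz).elim, oQ.2.1.1 hz, oQ.2.2.1 hz]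
  subst hij
  -- the member of the triple: compare the two markers
  rcases mem_padTriple_iff.1 hPi with rfl | rfl | rfl <;>
    rcases mem_padTriple_iff.1 hQj with rfl | rfl | rfl
  · rfl
  · exact (oP.1 ((hx _).2 (oQ.2.1.2 rfl))).elim
  · exact (oP.1 ((hx _).2 (oQ.2.2.2 rfl))).elim
  · exact (oQ.1 ((hx _).1 (oP.2.1.2 rfl))).elim
  · rfl
  · exact (eQ.2.2 ((hx _).1 (eP.2.1.2 rfl))).elim
  · exact (oQ.1 ((hx _).1 (oP.2.2.2 rfl))).elim
  · exact (eP.2.2 ((hx _).2 (eQ.2.1.2 rfl))).elim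
  · rfl

/-! ### Re-deriving the old clauses inside width `w + 1` -/

/-- **The padding is undone by two resolution steps inside width `w + 1`:**
`y ∨ C, ¬y ∨ z ∨ C.tail ⊢ z ∨ C` and `z ∨ C, ¬z ∨ C ⊢ C` (Ben-Sasson–Wigderson's `⊢_{w+1}`). -/
theorem resDerivable_of_mem_of_padCNF {B : ℕ} {Φ : CNF ℕ} {w : ℕ} (hw : 1 ≤ w)
    (hlen : ∀ C ∈ Φ, C.length = w) {C : Clause ℕ} (hC : C ∈ Φ) :
    ResDerivable (clauseSet (padCNF B Φ)) (w + 1) C.toFinset := by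
  classical
  obtain ⟨i, hi, rfl⟩ := List.getElem_of_mem hC
  set C := Φ[i] with hCdef
  set y := B + 2 * i with hy
  set z := B + 2 * i + 1 with hz
  have hCw : C.toFinset.card ≤ w := (List.toFinset_card_le C).trans (hlen C hC).le
  have memP : ∀ {P : Clause ℕ}, P ∈ padTriple B i C → P.toFinset ∈ clauseSet (padCNF B Φ) :=
    fun hP => mem_clauseSet_iff.2 ⟨_, padTriple_subset_padCNF hi hP, rfl⟩
  have h0 : ((y, true) :: C) ∈ padTriple B i C := mem_padTriple_iff.2 (Or.inl rfl)
  have h1 : ((y, false) :: (z, true) :: C.tail) ∈ padTriple B i C :=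
    mem_padTriple_iff.2 (Or.inr (Or.inl rfl))
  have h2 : ((z, false) :: C) ∈ padTriple B i C := mem_padTriple_iff.2 (Or.inr (Or.inr rfl))
  have hlen0 : ∀ {P : Clause ℕ}, P ∈ padTriple B i C → P.toFinset.card ≤ w + 1 := by
    intro P hP
    refine (List.toFinset_card_le P).trans ?_
    rcases mem_padTriple_iff.1 hP with rfl | rfl | rfl
    · rw [List.length_cons, hlen C hC]
    · rw [List.length_cons, List.length_cons, List.length_tail, hlen C hC]; omega
    · rw [List.length_cons, hlen C hC]
  -- step 1: `z ∨ C`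
  have hX : (insert (z, true) C.toFinset).card ≤ w + 1 :=
    (Finset.card_insert_le _ _).trans (Nat.add_le_add_right hCw 1)
  have step1 : ResDerivable (clauseSet (padCNF B Φ)) (w + 1) (insert (z, true) C.toFinset) := by
    refine ResDerivable.res (v := y) (b := true)
      (ResDerivable.ax (memP h0) subset_rfl (hlen0 h0))
      (ResDerivable.ax (memP h1) subset_rfl (hlen0 h1)) (by simp) (by simp) ?_ hX
    refine Finset.union_subset (Finset.subset_insert_iff.1 ?_) (Finset.subset_insert_iff.1 ?_)
    · intro l hl
      rw [List.toFinset_cons] at hl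
      rcases Finset.mem_insert.1 hl with rfl | hl
      · exact Finset.mem_insert_self _ _
      · exact Finset.mem_insert_of_mem (Finset.mem_insert_of_mem hl)
    · intro l hl
      rw [List.toFinset_cons, List.toFinset_cons] at hl
      rcases Finset.mem_insert.1 hl with rfl | hl
      · exact Finset.mem_insert_self _ _
      rcases Finset.mem_insert.1 hl with rfl | hl
      · exact Finset.mem_insert_of_mem (Finset.mem_insert_self _ _)
      · exact Finset.mem_insert_of_mem (Finset.mem_insert_of_mem
          (List.mem_toFinset.2 (List.mem_of_mem_tail (List.mem_toFinset.1 hl))))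
  -- step 2: `C`
  refine ResDerivable.res (v := z) (b := true) step1
    (ResDerivable.ax (memP h2) subset_rfl (hlen0 h2)) (Finset.mem_insert_self _ _) (by simp) ?_
    (hCw.trans (Nat.le_succ w))
  refine Finset.union_subset (Finset.subset_insert_iff.1 subset_rfl) (Finset.subset_insert_iff.1 ?_)
  intro l hl
  rw [List.toFinset_cons] at hl
  exact hl

/-- **Width goes up by exactly one**: `clauseSet Φ ⊢_w ∅` implies `clauseSet (padCNF B Φ) ⊢_{w+1} ∅`
(cut on the re-derived old clauses). -/
theorem resDerivable_padCNF {B : ℕ} {Φ : CNF ℕ} {w : ℕ} (hw : 1 ≤ w)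
    (hlen : ∀ C ∈ Φ, C.length = w) (h : ResDerivable (clauseSet Φ) w ∅) :
    ResDerivable (clauseSet (padCNF B Φ)) (w + 1) ∅ := by
  refine ResDerivable.trans_axioms (fun A hA _ => ?_) (h.mono (Nat.le_succ w))
  obtain ⟨C, hC, rfl⟩ := mem_clauseSet_iff.1 hA
  exact resDerivable_of_mem_of_padCNF hw hlen hC

end ResLinPC

end Summit.PneNP.PneNP.Theorems
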